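import Mathlib
import HarnessLib
import HarnessLib.Audit
import Summits.CriticalPhenomena.Statement
import Literature.Probability.RandomPlanarGeometry.ConformalRectangle
import Literature.Probability.RandomPlanarGeometry.CardyFunction
import Literature.Probability.Percolation.Crossings
import HarnessLib.Audit.Status.Attr

/-!
Route: ModulusResponse

DORMANT since 2026-08-25T03:46:32Z (reconciler: no traction for 7.3 d (last activity item-evidence-added at 2026-08-17T18:59:51Z); parked, not closed — `ledger route dormant route-CriticalPhenomena-ModulusResponse --off` to reactivate) — unstaffed, not closed; items shared with open routes are served there. `ledger route dormant <id> --off` reactivates.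

# Route ModulusResponse — transport linear-image Cardy from Smirnov's point along the self-dual cell
segment; motion by linear response; the quarter turn pins the square

It suffices to show X = LinearImageCardyZ2: there is ONE real number t such that for every conformal
rectangle R the P_{1/2}
bond-ℤ² crossing probability (G02 discretisation `discreteCrossingProb`) of the diagonally stretched
rectangle S_t(R),
S_t z = cosh t · z + i sinh t · z̄ (stretch by e^t along x = y, e^{-t} along x = -y), tends to
F(η(R)) as δ → 0⁺ — Cardy's
formula up to an unidentified diagonal linear map (the Langlands–Pouliot–Saint-Aubin form; t = 0 is
CardyFormulaZ2 verbatim, and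
the quarter-turn symmetry of ℤ² forces t = 0: support item SquarePinning). X is attacked along the
SELF-DUAL CELL SEGMENT μ_u,
u ∈ [0, 1/2]: the 1-dependent bond model on ℤ² whose cells {left edge, down edge} at each vertex
have law
P(both) = P(none) = (1-u)/2, P(one) = u/2 each — u = 0 is Smirnov's site percolation on 𝕋 (cell ↔
site of `triGraph`),
u = 1/2 IS Bernoulli bond percolation at 1/2 (μ_u is the point reflection of the corner family
M_{2u} of route
CardySelfDualSegment, opened in parallel for card self-dual-cell-segment: same segment, DIFFERENT
decomposition — there the modulus is
"never computed" and moved by an open/closed continuity method resting on a law-level rigidity crux;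
here it is COMPUTED to first order
at the solved end and transported by linear response / compensation, with uniform RSW as an explicit
crux). Card realised:
modulus-response-at-smirnov-point (spine: crux SmirnovResponse = its R1; the transport and RSW
cruxes are this card's "hand-off" items
made load-bearing).
Lean: `∀ (S : ℝ → ℂ → ℂ), (∀ t z, S t z = (Real.cosh t : ℂ) * z + Complex.I * (Real.sinh t : ℂ) *
(starRingEnd ℂ) z) → ∃ t : ℝ, ∀ R : Literature.Probability.RandomPlanarGeometry.ConformalRectangle,
R.HasCrossingLimit (fun δ ↦ Literature.Probability.Percolation.discreteCrossingProb
Literature.Probability.Percolation.half (S t '' R.carrier) δ (S t '' R.arc 0) (S t '' R.arc 2))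
Literature.Probability.RandomPlanarGeometry.cardyFunction`

## Assembly
Deciding theorem (rev 2, planner glue, lean-checked sorry-free, axioms
propext/Classical.choice/Quot.sound): `closes : SmirnovResponse → SegmentRSW → SmirnovCellAnchor →
SegmentTransport → BondIdentification → SquarePinning → CardyFormulaZ2`; the item `Assembly` states
the same implication. Pure logic plus one rewrite: SquarePinning reduces CardyFormulaZ2 to X;
instantiate the pinned family μ and the stretches S by their defining terms (hypotheses by `rfl`);
SegmentRSW gives the box-crossing input, SmirnovCellAnchor gives linear-image Cardy at u = 0 with t₀
= -(log 3)/4, SmirnovResponse gives the first-order response law at u = 0 (since rev 2 an explicit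
antecedent of SegmentTransport, answering objection O1 of the route review: every crux now bears
load), SegmentTransport carries linear-image Cardy to u = 1/2, and BondIdentification rewrites
μ(1/2) into `bondPercolation (zdGraph 2) half` so that the conclusion is literally X
(`discreteCrossingProb` unfolds by `rfl`). Since rev 5 the chain is itemised for the closure graph
(A11): the support item LinearImageFromSegment states SegmentRSW → SmirnovCellAnchor →
SmirnovResponse → SegmentTransport → BondIdentification → LinearImageCardyZ2 (inputs first, the
target BY NAME; pure logic, exactly the body of `closes`; filed at rank 10 so that it is rendered
after the rank-9 supports it quotes — its rev-4 twin SegmentChainGlue at rank 9 was rendered before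
BondIdentification, blocked as a forward reference, and dropped), and SquarePinning is X →
CardyFormulaZ2, so pointwise `closes` = SquarePinning ∘ LinearImageFromSegment up to the order of
hypotheses.

Rationale: WHY THIS LINE. Beffara asks, for percolation, to DETERMINE the linear map g conjugating scaling
limits of two lattices (Beffara2008Universal §1,
arXiv p. 3) and shows every embedding-blind argument is powerless (Prop. 4); his own interpolation
(§5.2, Prop. 18) runs between two
UNSOLVED square-symmetric models where ∂_q P must vanish and the shift pairing fails (barrier
CoveringLatticeShift). Here the
interpolation starts at the one SOLVED point and runs along an honestly asymmetric self-dual family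
(Chayes–Lei packaged
triangles with singles (t, t, 0), ChayesLei2007 §2.1; critical for every u by BollobasRiordan2010
Cor. 2.3, FKG iff u ≤ 1/2), so
∂_u P does NOT vanish: its leading δ^{-3/4} part is killed by self-duality and what survives must be
an infinitesimal diagonal
STRETCH with one non-universal constant — the lattice-anisotropy ↔ stress-tensor response of
Cardy1996 §11.3 (K_x = K(1-λε)),
made computable at u = 0 by differentiating Smirnov's contour identity
(Smirnov2009CriticalPercolation Lemma 2.1) and reading
the remainder off pivotal/IIC ratio limits (GarbanPeteSchramm2013Pivotal). BollobasRiordan2010 p. 40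
print exactly the
target form ("Cardy's formula, after first applying a suitable linear transformation") as the
conjecture for self-dual
hyperlattices; DKKMO2020Rotational Thm 1.9 proves the analogue for INTEGRABLE isoradial
deformations. Imported areas:
linear response / conformal perturbation theory (physics, with the explicit dictionary defect
density u ↦ log-stretch τ(u)),
self-dual hypergraph percolation (combinatorics), pivotal-measure technology (probability). Relative
to card self-dual-cell-segment
(whose audit found "closedness is soft" false: termwise the Russo derivative is O(δ^{-3/4}) and the
marginality cancellation must be
PROVED), this route makes that cancellation-plus-response the rank-2 crux at the one point where it
is a theorem-sized statement, and
states transport as ONE crux with uniform RSW as a separate crux (the π-rotation alone is NOT a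
symmetry of μ_u — it maps the
{left, down} pairing to {right, up} — so KST-type RSW is not automatic). Route CardySelfDualSegment
(same family) defers exactly the
statement filed here at rank 2 to a future layer-2 child ("FirstOrderAtSmirnovPoint", boundedness
only) of its UniformMarginality;
this route bets on the RESPONSE FORM (one constant k, Beffara's "determine g" to first order) as the
decidable entry point and on
compensation rather than law-level CLE rigidity for transport. The negatives index (stmt-0772, SAW)
is untouched.

RANKED CRUXES. #0 LinearImageCardyZ2 (target) — X: for the diagonal stretches S_t (pinned by their
formula) there is one t with P_{1/2}[open crossing of S_t(R) in δℤ², G02 recipe] → F(η(R)) for every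
conformal rectangle R (Cardy up to a diagonal linear map; LPS/Beffara's g for ℤ² up to the symmetry
step). (why it might fail: It is CardyFormulaZ2 up to one real parameter t; fails if bond-ℤ²
crossing probabilities have no scaling limit, or a limit that is not Cardy composed with a linear
map (Zhang arXiv:2206.04599 announces failure of Cardy on ℤ²; unrefereed).) [Beffara2008Universal,
LanglandsPouliotSaintaubin1994, BollobasRiordan2010, Schramm2007ICM]
#2 SmirnovResponse (crux) — (card modulus-response-at-smirnov-point, item R1) FIRST-ORDER RESPONSE
AT SMIRNOV'S POINT IS A STRETCH: for the cell family μ_u and stretches S_t (both pinned by their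
defining equations) there is ONE constant k such that for every conformal rectangle R and every
pre-stretch t, whenever the limiting u = 0 crossing probability s ↦ lim_δ μ_0[cross S_s(R)] has
derivative L at s = t, the right u-derivative at 0 of the finite-mesh crossing probability u ↦
μ_u[cross S_t(R)] tends to k·L as δ → 0⁺ (k = -τ'(0), τ(u) the compensating log-stretch; the card's
l(ν)). [difficulty: L] (why it might fail: The O(u) term needs the SUBLEADING (relative order
δ^{3/4}, spin-2) anisotropy of arm-attachment statistics at defect cells; if it is not carried by
increments of Smirnov's H's a rate-of-ratio-limit theorem at 3-arm points, not in print, is needed;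
k might depend on R (no linear regime).) [Beffara2008Universal, Smirnov2009CriticalPercolation,
GarbanPeteSchramm2013Pivotal, SmirnovWerner2001, Cardy1996, ChayesLei2007, BinderChayesLei2010]
#3 SegmentTransport (crux) — (card self-dual-cell-segment, transport; rev 2: response antecedent
added) LINEAR-IMAGE CARDY PROPAGATES ALONG THE SEGMENT: given uniform box-crossing bounds for μ_u, u
∈ [0,1/2], one t₀ with μ_0[cross S_{t₀}(R)] → F(η(R)) for all R, and the first-order response law at
u = 0 (the conclusion of SmirnovResponse for the same μ, S: one k with ∂_u⁺|_{u=0} μ_u[cross S_t(R)]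
→ k·L as δ → 0⁺ whenever s ↦ lim_δ μ_0[cross S_s(R)] has derivative L at s = t), for every u ∈
[0,1/2] there is t = τ(u) with μ_u[cross S_t(R)] → F(η(R)) for all R. Intended proof: compensation
principle (perturbing the cell law by Δu ≡ stretching the domain by τ'(u)Δu up to O(Δu²), uniformly
in δ) integrated from u = 0; the response law is its base instance (u = 0), the compensation at u >
0 is the open content. [deps: SmirnovResponse, SegmentRSW, SmirnovCellAnchor] [difficulty:
open-problem] (why it might fail: No mechanism at u>0: swapping d/du with δ→0 needs uniform-in-δ
control of pivotal attachment anisotropies at an unsolved point — the subleading arm asymptotics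
that are open on ℤ²; universality-mod-linear-map is itself only conjectured (BollobasRiordan2010
p.40).) [BollobasRiordan2010, Beffara2008Universal, LanglandsPouliotSaintaubin1994,
DKKMO2020Rotational, GarbanPeteSchramm2013Pivotal, GiulianiMastropietroToninelli2017]
#4 SegmentRSW (crux) — UNIFORM RSW ON THE SEGMENT: one c > 0 with μ_u[LR crossing of [0,2n]×[0,n]] ≥
c and μ_u[TB crossing of [0,n]×[0,2n]] ≥ c for all u ∈ [0,1/2], n ≥ 1 (μ_u pinned by its defining
equation). Inputs available: FKG (u ≤ 1/2), 1-dependence, exact self-duality composed with the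
π-rotation and the diagonal reflection x ↔ y (together: open left–right crossing probability exactly
1/2, up to boundary rounding, for every axis-parallel square; the π-rotation ALONE is not a
symmetry: it maps the {left, down} pairing to {right, up}), criticality (BollobasRiordan2010 Thm
2.1/Cor 2.3), power-law radius bounds (Thm 8.1). [difficulty: M] (why it might fail: μ_u is FKG and
self-dual only up to a π-rotation, invariant under translations and ONE diagonal reflection:
KohlerSchindlerTassion2023 Thm 1 needs the full symmetry group of ℤ² (p.5); BollobasRiordan2010 get
criticality (Thm 2.1) but leave box-crossing as Conj. 8.2.) [BollobasRiordan2010,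
KohlerSchindlerTassion2023, ChayesLei2007, GrimmettManolescu2014]
#5 SmirnovCellAnchor (support; re-badged rev 3: Smirnov's theorem is proved in tree, the
ℤ²-cell/𝕋-site discretisation sandwich is bookkeeping) — SMIRNOV AT u = 0 IN THE ℤ² FRAME: μ_0[cross
S_{t₀}(R)] → F(η(R)) for every conformal rectangle R with t₀ = -(log 3)/4. Reason: μ_0-clusters are
the site clusters of `triGraph` (cell m ↔ site m, same index set as `triMeshVertices` of the sheared
domain), the frame change G(x+iy) = x + e^{iπ/3}y makes 𝕋 equilateral, and G∘S_{t₀} is a similarity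
(GᵀG has eigenvalues 3/2, 1/2 on the diagonals); then Smirnov's theorem (tree:
hasCrossingLimit_triDomainCrossingProb_holds) and a cell/site discretisation sandwich. [difficulty:
M] (why it might fail: Discretisation transfer for arbitrary Jordan domains: G02's largest-component
recipes on ℤ² (cells) and on 𝕋 (sites) may pick different bulk components when the frontier has
positive area; the tree's sandwich (BR2006 Lemma 14) is proved for the 𝕋 recipe only.) [Smirnov2001,
Smirnov2009CriticalPercolation, BollobasRiordan2006, ChayesLei2007, Beffara2008Universal]
#9 BondIdentification (support) — at u = 1/2 the cell measure IS Bernoulli bond percolation on ℤ² at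
1/2: μ(1/2) = bondPercolation (zdGraph 2) half ((X, X xor D) with X, D independent fair bits is a
pair of independent fair bits; every edge of ℤ² is the left or down edge of exactly one vertex;
non-edges never occur). [difficulty: provable-now] [Grimmett1999, Beffara2008Universal]
#9 SquarePinning (support) — X → CardyFormulaZ2: the quarter turn ρ of ℤ² is an exact symmetry of
`discreteCrossingProb half` and conjugates S_t to S_{-t}, so X gives F(η(R̃)) = F(η(S_{-2t}R̃)) for
all R̃; F is strictly increasing (tree: strictMonoOn_cardyFunction_holds), so S_{2t} preserves every
conformal modulus, which forces t = 0 (a non-conformal linear map distorts some modulus: the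
geometric step of Beffara2008Universal Prop. 4, BeffaraShearDistortsModulus — PROVED in tree,
`BeffaraShearDistortsModulus_holds` in
Literature/Barriers/CriticalPhenomena/EmbeddingModulusUniquenessProofs.lean; remaining formal input:
ρ-equivariance of G02's `discreteCrossing`/`discreteArc` recipe, cf.
quadCrossingProb_rotateQuad_pi_div_two in QuadCrossingRotationInvarianceProofs.lean); t = 0 is
CardyFormulaZ2 by `bondDomainCrossingProb_eq`. [difficulty: M] [Beffara2008Universal,
DKKMO2020Rotational, Werner2007]
#10 LinearImageFromSegment (support, glue; rank 10 only so that the gate renders it after the rank-9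
supports it quotes) — the chain reaches the target BY NAME, inputs first: SegmentRSW →
SmirnovCellAnchor → SmirnovResponse → SegmentTransport → BondIdentification → LinearImageCardyZ2.
Pure logic (the body of `closes`): for the pinned stretches S instantiate the pinned cell family μ
(hypothesis by `rfl`), apply SegmentTransport at u = 1/2 ∈ [0,1/2] fed by SegmentRSW, the anchor ⟨t₀
= -(log 3)/4, SmirnovCellAnchor⟩ and SmirnovResponse, and rewrite μ(1/2) by BondIdentification
(`discreteCrossingProb` unfolds by `rfl`); checked sorry-free in the planner's sketch (axioms
propext/Classical.choice/Quot.sound). Added at rev 4–5 (route-repair, A11 target reachability: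
before it no item concluded LinearImageCardyZ2; the rev-4 filing SegmentChainGlue,
stmt-CriticalPhenomena-14142, same statement at rank 9, was rendered before BondIdentification and
blocked by the gate as a forward reference, so rev 5 drops it and re-files the glue under this name
at rank 10; `closes` itself is unchanged). [deps: SmirnovResponse, SegmentRSW, SmirnovCellAnchor,
SegmentTransport, BondIdentification] [difficulty: provable-now] [Smirnov2001, Beffara2008Universal,
BollobasRiordan2010]

TWO-LAYER PLAN. Foreseen glued splits (none filed now): SegmentTransport ⇐ UniformCompensation (for
every u ∈ [0,1/2]: limsup_δ |μ_{u+Δ}[cross S_t R] -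
μ_u[cross S_{t+κ(u)Δ} R]| ≤ K Δ², one bounded κ, all R, t) → TelescopingBookkeeping →
SegmentTransport; SmirnovResponse ⇐
DifferentiatedContourIdentity (exact finite-mesh identity with defect phases, card R2) →
ForcedCancellationIIC (the ν-phase-weighted
switching defect has zero mean under the 3-arm / 4-arm incipient measure of site-𝕋, card R3) →
SmirnovResponse; SegmentRSW ⇐
SquareCrossingHalf (duality ∘ π-rotation, then x ↔ y) → OneReflectionKST (KST §6
symmetric-domination variant) → SegmentRSW;
SmirnovCellAnchor ⇐ FrameChange (index bijection + similarity) → CellSiteSandwich (BR2006 Lemma 14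
style) → SmirnovCellAnchor.

KILL CRITERIA. Refutation of SmirnovResponse in the form "the response converges but is not
k·(stretch derivative) with one k for all R, t"
(z-dependent Beltrami coefficient) kills the effective-linear-map picture at the solved point: close
`refuted:SmirnovResponse` and
notify cards self-dual-cell-segment / smirnov-to-square-shear-flow (their ODE ansatz dies too).
¬SegmentRSW (box crossing fails for
some u ≤ 1/2) leaves no a-priori control: close. ¬SegmentTransport by a u whose limits exist but are
not linear-image Cardy refutes
LPS universality — close and file the witness as a negative. ¬BondIdentification or
¬SmirnovCellAnchor by a mis-specified family or
constant ⇒ pivot by `--restate` (same mechanism, corrected term). CardyFormulaZ2 or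
CardyUniqueLimit.X_U + rigidity proved elsewhere
moots the route; if route CardySelfDualSegment splits its UniformMarginality, SmirnovResponse should
be attached there too (wanted_by)
and the two routes' transport cruxes compared by the tenure planners (`close --reason superseded
--by` for the weaker one).

NOT DECOMPOSED YET. The compensation principle and its constants (children of SegmentTransport); the
exact IIC identity and the defect-phase bookkeeping
(children of SmirnovResponse); measurability / product-structure lemmas for the pinned push-forward
family (prover-side helpers,
`--supports`); the modulus-distortion lemma SquarePinning needs (a diagonal stretch preserving every
conformal modulus is trivial —
problem-side; the non-trivial direction is the proved fact BeffaraShearDistortsModulus_holds); the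
far end u ∈ (1/2, 1] of the segment (non-FKG, coalescing
paths / Brownian web at u = 1) and a second perturbation direction (the full 2-parameter g) —
deliberately outside this route.

CHEAPEST FALSIFIER. Monte Carlo of the response at the solved end (card test (b)), not run here (no
kit job submitted in plancard mode): sample μ_u for
u ∈ {0, 0.05, 0.1} on diagonal-frame boxes of side L ∈ {64, 128, 256} lattice units, measure
crossing probabilities of 4–6 shapes
(rhombi and rectangles aligned with x = ±y, aspect ratios 1, 1.5, 2, both crossing directions), and
fit ONE k in
"P_u(R) ≈ P_0(S_{-ku} R)": the route predicts a shape-independent k with total drift τ(1/2) - τ(0) =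
(log 3)/4 ≈ 0.275 over the
segment (crossing-probability shifts ≈ 0.01–0.02 at u = 0.1, so ≥ 10⁵ samples per point); a
shape-dependent k at fixed L → ∞ trend
refutes SmirnovResponse. Cheaper still, by hand: BondIdentification and the anchor constant t₀ =
-(log 3)/4 (GᵀG = [[1,1/2],[1/2,1]],
eigenvalues 3/2, 1/2) — checked in this session on paper.

NUMBERS. t₀ = τ(0) = -(ln 3)/4 ≈ -0.2747 (effective axis ratio e^{-2t₀} = √3 between the diagonals
at u = 0), τ(1/2) = 0 (pinned); FKG iff
u ≤ 1/2 (cell law log-supermodular iff ((1-u)/2)² ≥ (u/2)²; ChayesLei2007 §2.1: ae ≥ 2s² in the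
symmetric case); pivotal density δ^{5/4}
per cell × δ^{-2} cells = δ^{-3/4} leading Russo term, killed by self-duality; surviving spin-2 part
of relative order δ^{3/4} = gap
between the stress-tensor dimension 2 and the 4-arm dimension 5/4 (SmirnovWerner2001 exponents 5/4,
2/3); Beffara's counts
Δ(v) ≈ δ^{9/4} vs the needed o(δ²) (Beffara2008Universal §5.2). KST Thm 1: symmetry group Σ = ⟨ℤ²,
quarter turn, one reflection⟩
required; μ_u has ⟨ℤ², x ↔ y⟩ and duality∘(π-rotation). Items at open: 8 (4 cruxes); rev 2
(route-repair): SegmentTransport restated 1:1 with the response antecedent, deciding theorem made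
direct over the six chain items, declared imports narrowed to ConformalRectangle + CardyFunction +
Crossings (the items' actual vocabulary; decl cone 50 project constants, 0 unproved facts besides
the target); rev 3 (retriage): SmirnovCellAnchor crux → support (3 cruxes: SmirnovResponse,
SegmentTransport, SegmentRSW); rev 4–5 (route-repair, badge + choice): glue support item
LinearImageFromSegment added at rank 10 (its rank-9 twin SegmentChainGlue dropped: forward reference
to BondIdentification in the gate's render order) — 9 active items (target, 3 cruxes, 4 supports,
assembly), `closes` unchanged.

DEFINITION REQUESTS. None needed to type the items: the cell family μ and the stretches S are pinned
inside each Prop by their defining equations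
(push-forward of setBer(univ, 1/2) ⊗ setBer(univ, u) under the cell map; S t z = cosh t z + i sinh t
z̄). If a Literature
definition `cellSegmentMeasure` / `diagStretch` is later wanted to shorten signatures it can replace
the pinned hypotheses 1:1.

Novelty: Searches (2026-08-15): `ledger negatives --problem CriticalPhenomena` (1, unrelated); `ledger idea
list --sub CardyFormulaZ2` (125 cards,
0 routed; siblings self-dual-cell-segment, smirnov-to-square-shear-flow, corner-fugacity-plane read
via the spine card); the six
Theses/*.lean of the sub (no interpolation route); `lit frontier CriticalPhenomena --since 2020` (30
rows, none on effective moduli);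
`lit bridges CriticalPhenomena --cross any` (30 rows, none); `lit search --hybrid "crossing
probabilities planar percolation positive
association symmetry RSW"` (10 books); `lit vsearch` "anisotropic perturbation … Cardy after a
linear change of aspect ratio" (10 books →
Cardy1996 §11.3 read, p. 216); `lit read` with grep of arXiv:0708.3908 (pp. 3, 13–16),
arXiv:2011.04618 (pp. 3, 5, 13),
arXiv:1001.4674 (pp. 4, 7–9, 38–40), math-ph/0601023 (pp. 4–6); `lit galaxy search --star all`
"anisotropic percolation effective
aspect ratio" / "Cardy's formula anisotropic" (0 rows each; a third query queued out); openalex / s2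
/ arxiv APIs returned HTTP 429 all
session (recorded, not worked around).
Nearest prior art found: Beffara2008Universal §5.2 (model interpolation between two unsolved
square-symmetric models; derivative
must vanish; blocked by the shift pairing) and §4.2 (rates diagnosis); BollobasRiordan2010 p. 40
(the target form as a conjecture for
self-dual hyperlattices, no mechanism) and Cor. 2.3 (criticality of the family); DKKMO2020Rotational
Thm 1.9 (universality modulo a
linear  [refs: 0708.3908, 2011.04618, 1001.4674, Cardy1996, BollobasRiordan2010, ChayesLei2007, GiulianiMastropietroToninelli2017]

Barriers (technique_class: linear-response, model-interpolation, smirnov-perturbation): - technique_class: linear-response, model-interpolation, smirnov-perturbation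
- Literature.Barriers.CriticalPhenomena.EmbeddingModulusUniqueness: evaded at both ends and conceded
in the middle by design — the stretch is COMPUTED at u = 0 from Smirnov's exact identity (evasion
(ii): integrable input at the isotropic point) and PINNED at u = 1/2 by the order-4 rotation of ℤ²
(evasion (i), SquarePinning); the transport crux is stated in the "modulo an unidentified linear
map" form (∃ t) that the barrier's audit lists as NOT blocked.
- Literature.Barriers.CriticalPhenomena.SmirnovTriangularOnly: respected — colour switching / the
contour identity are used only at ψ ≡ 0 (u = 0, equilateral frame) and differentiated there; nothing
is transplanted verbatim to ℤ²; the defect terms at pair-state cells are the object of study, not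
assumed to vanish.
- Literature.Barriers.CriticalPhenomena.CoveringLatticeShift: not triggered — no covering lattice,
no type-exchanging pairing; ∂_u P is not claimed to vanish (it is compensated by a stretch), and the
family keeps a u-independent symmetry group (translations, x ↔ y, duality∘π-rotation) exactly as the
barrier's "not blocked (a)" clause requires for RSW-type inputs.
- Literature.Barriers.CriticalPhenomena.CoveringLatticeShiftNarrow: not triggered — the route runs
no interpolation inside Beffara's P_{1/2,q} and uses no type-exchanging lattice symmetry or global
colour flip as an exact identity; on our family the only exact identities used (squa

Novelty grade: new-combination — ROUTE REVIEW (refuter) 2026-08-15. STATE: OPEN but UNMATERIALISED (rev 0, commit -, deps [], no Theses/ModulusResponse.lean; "Items at open: 8" never filed) ⇒ nothing to stamp; planner/gate must re-materialise first. CHECKS on the thesis text: target X elaborates verbatim (W1.lean rc0) and CardyForm (refuter refuter-rreview-route-CriticalPhenomena--178cf7d2-g3-0, 2026-08-15T14:43:32Z; prior: arXiv:0708.3908 Beffara2008Universal §4.2/§5.2/Prop.4, arXiv:1001.4674 BollobasRiordan2010 Cor.2.3, p.40, Conj.8.2, Cardy1996 §11.3 (anisotropy = stress-tensor response), DKKMO2020Rotational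 Thm 1.9 (integrable isoradial deformations), ChayesLei2007 §2.1, route-CriticalPhenomena-CardySelfDualSegment (same segment, continuity method))

History (route lifecycle, newest last):
- 2026-08-15T16:53:25Z · rev 2: restated SegmentTransport (stmt-CriticalPhenomena-6469) — route-repair(cone) g2, unit rrepair-CriticalPhenomena-ModulusRespo-8c6e0bc2-g2: needs-fact: none. DIAGNOSIS: the 16 unproved facts of the module (file-import) c (planner-rrepair-CriticalPhenomena-ModulusRespo-8c6e0bc2-g2-0)
- 2026-08-16T03:23:28Z · rev 5: dropped stmt-CriticalPhenomena-14142 — route-choice (a) pass 2, unit rchoice-CriticalPhenomena-ModulusRespo-eebdbb12: the rev-4 glue item SegmentChainGlue (stmt-CriticalPhenomena-14142, rank 9) was r (planner-rchoice-CriticalPhenomena-ModulusRespo-eebdbb12-0)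
- 2026-08-25T03:46:32Z · DORMANT — reconciler: no traction for 7.3 d (last activity item-evidence-added at 2026-08-17T18:59:51Z); parked, not closed — `ledger route dormant route-CriticalPhenomen (operator:999:3750828)

sub-problem: CardyFormulaZ2 · status: dormant · opened planner-plancard-CriticalPhenomena-CardyFormu-10df8d9b-0 2026-08-15T11:47:10Z · rev 6 · ledger route-CriticalPhenomena-ModulusResponse
GENERATED by the gate from the ledger (D-0016/17). Provers cite these decls: `theorem foo : Summit.CriticalPhenomena.CardyFormulaZ2.Theses.ModulusResponse.<Decl> := …` in Summits/CriticalPhenomena/CardyFormulaZ2/Theorems/<Name>.lean.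
-/

namespace Summit.CriticalPhenomena.CardyFormulaZ2.Theses.ModulusResponse

open scoped BigOperators Topology Manifold Classical MeasureTheory ProbabilityTheory Matrix InnerProductSpace ComplexConjugate ContinuousMap
open Filter Set Function TopologicalSpace MeasureTheory

attribute [summit_statement] _root_.CardyFormulaZ2

/-- item stmt-CriticalPhenomena-6467 · target · rank 0 · open · by planner
why it might fail: It is CardyFormulaZ2 up to one real parameter t; fails if bond-ℤ² crossing probabilities have no scaling limit, or a limit that is not Cardy composed with a linear map (Zhang arXiv:2206.04599 announces failure of Cardy on ℤ²; unrefereed).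
sources: Beffara2008Universal, LanglandsPouliotSaintaubin1994, BollobasRiordan2010, Schramm2007ICM
[target] X: for the diagonal stretches S_t (pinned by their formula) there is one t with
P_{1/2}[open crossing of S_t(R) in δℤ², G02 recipe] → F(η(R)) for every conformal rectangle R (Cardy
up to a diagonal linear map; LPS/Beffara's g for ℤ² up to the symmetry step). -/
@[route_item "route-CriticalPhenomena-ModulusResponse", crux]
def LinearImageCardyZ2 : Prop :=
  ∀ (S : ℝ → ℂ → ℂ), (∀ t z, S t z = (Real.cosh t : ℂ) * z + Complex.I * (Real.sinh t : ℂ) * (starRingEnd ℂ) z) → ∃ t : ℝ, ∀ R : Literature.Probability.RandomPlanarGeometry.ConformalRectangle, R.HasCrossingLimit (fun δ ↦ Literature.Probability.Percolation.discreteCrossingProb Literature.Probability.Percolation.half (S t '' R.carrier) δ (S t '' R.arc 0) (S t '' R.arc 2)) Literature.Probability.RandomPlanarGeometry.cardyFunction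

/-- item stmt-CriticalPhenomena-6468 · crux · rank 2 · open · by planner
why it might fail: Termwise the u-derivative is a Russo sum of δ⁻² cells × 4-arm prob δ^(5/4) = δ^(-3/4); cancellation to O(1) is forced only heuristically (GPS2013 ratio limits + the exact square identity), the 5-arm/4-arm gap is exactly 3/4 so a log δ divergence is possible, and k may depend on R or t.
sources: Beffara2008Universal, GarbanPeteSchramm2013Pivotal, SmirnovWerner2001, Smirnov2009CriticalPercolation, Cardy1996, ChayesLei2007
[crux] (card modulus-response-at-smirnov-point, item R1) FIRST-ORDER RESPONSE AT SMIRNOV'S POINT IS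
A STRETCH: for the cell family μ_u and stretches S_t (both pinned by their defining equations) there
is ONE constant k such that for every conformal rectangle R and every pre-stretch t, whenever the
limiting u = 0 crossing probability s ↦ lim_δ μ_0[cross S_s(R)] has derivative L at s = t, the right
u-derivative at 0 of the finite-mesh crossing probability u ↦ μ_u[cross S_t(R)] tends to k·L as δ →
0⁺ (k = -τ'(0), τ(u) the compensating log-stretch; the card's l(ν)). [difficulty: L] -/
@[route_item "route-CriticalPhenomena-ModulusResponse", crux]
def SmirnovResponse : Prop :=
  ∀ (μ : ℝ → MeasureTheory.Measure (Literature.Probability.Percolation.BondConfig (Literature.Probability.LatticeModels.Site 2))) (S : ℝ → ℂ → ℂ), (∀ u, μ u = MeasureTheory.Measure.map (fun p : Set (Literature.Probability.LatticeModels.Site 2) × Set (Literature.Probability.LatticeModels.Site 2) ↦ {e | ∃ m, (m ∈ p.1 ∧ e = s(m - Pi.single 0 1, m)) ∨ ((m ∈ p.1 ↔ m ∉ p.2) ∧ e = s(m - Pi.single 1 1, m))}) ((ProbabilityTheory.setBernoulli Set.univ Literature.Probability.Percolation.half).prod (ProbabilityTheory.setBernoulli Set.univ (Set.projIcc 0 1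 zero_le_one u)))) → (∀ t z, S t z = (Real.cosh t : ℂ) * z + Complex.I * (Real.sinh t : ℂ) * (starRingEnd ℂ) z) → ∃ k : ℝ, ∀ (R : Literature.Probability.RandomPlanarGeometry.ConformalRectangle) (t L : ℝ), HasDerivAt (fun s : ℝ ↦ limUnder (nhdsWithin (0 : ℝ) (Set.Ioi 0)) (fun δ ↦ (μ 0).real (Literature.Probability.Percolation.discreteCrossing (S s '' R.carrier) δ (S s '' R.arc 0) (S s '' R.arc 2)))) L t → Filter.Tendsto (fun δ ↦ derivWithin (fun u ↦ (μ u).real (Literature.Probability.Percolation.discreteCrossing (S t '' R.carrier) δ (S t '' R.arc 0) (S t '' R.arc 2))) (Set.Ici 0) 0) (nhdsWithin 0 (Set.Ioi 0)) (nhds (k * L))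

-- earlier SegmentTransport (stmt-CriticalPhenomena-6469, replaced 2026-08-15T16:53:25Z -> stmt-CriticalPhenomena-11199): retired by None — ∀ (μ : ℝ → MeasureTheory.Measure (Literature.Probability.Percolation.BondConfig (Literature.Probability.LatticeModels.Site 2))) (S : ℝ → ℂ → ℂ), (∀ u, μ u = MeasureTheory.Measure.map (fun p : Set (Literature.Probability.LatticeModels.Site 2) × Set (Literature.Pro
/-- item stmt-CriticalPhenomena-11199 · crux · rank 3 · open · by planner
why it might fail: It is the LPS / BollobasRiordan2010 p.40 conjecture (Cardy after a linear map) restricted to μ_u, 0<u≤1/2: no mechanism at u>0 — uniform-in-δ compensation needs subleading pivotal-anisotropy control at an UNSOLVED point; one u with no limit or a non-linear-image limit refutes it.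
sources: BollobasRiordan2010, Beffara2008Universal, LanglandsPouliotSaintaubin1994, DKKMO2020Rotational, GarbanPeteSchramm2013Pivotal, GiulianiMastropietroToninelli2017
[crux] (card self-dual-cell-segment, transport; rev 2: response antecedent added, route-review O1)
LINEAR-IMAGE CARDY PROPAGATES ALONG THE SEGMENT: given uniform box-crossing bounds for μ_u, u ∈
[0,1/2], one t₀ with μ_0[cross S_{t₀}(R)] → F(η(R)) for all R, and the first-order response law at u
= 0 (the conclusion of SmirnovResponse for the same μ, S: one constant k with ∂_u⁺|_{u=0} μ_u[cross
S_t(R)] → k·L as δ → 0⁺ whenever s ↦ lim_δ μ_0[cross S_s(R)] has derivative L at s = t), for every u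
∈ [0,1/2] there is t = τ(u) with μ_u[cross S_t(R)] → F(η(R)) for all R (μ_u, S_t pinned by their
defining equations). Intended proof: compensation principle (perturbing the cell law by Δu ≡
stretching the domain by τ'(u)Δu up to O(Δu²), uniformly in δ) integrated from u = 0; the response
law is its base instance, the compensation at u > 0 is the open content. [deps: SmirnovResponse,
SegmentRSW, SmirnovCellAnchor] [difficulty: open-problem] -/
@[route_item "route-CriticalPhenomena-ModulusResponse", crux]
def SegmentTransport : Prop :=
  ∀ (μ : ℝ → MeasureTheory.Measure (Literature.Probability.Percolation.BondConfig (Literature.Probability.LatticeModels.Site 2))) (S : ℝ → ℂ → ℂ), (∀ u, μ u = MeasureTheory.Measure.map (fun p : Set (Literature.Probability.LatticeModels.Site 2) × Set (Literature.Probability.LatticeModels.Site 2) ↦ {e | ∃ m, (m ∈ p.1 ∧ e = s(m - Pi.single 0 1, m)) ∨ ((m ∈ p.1 ↔ m ∉ p.2) ∧ e = s(m - Pi.single 1 1, m))}) ((ProbabilityTheory.setBernoulli Set.univ Literature.Probability.Percolation.half).prod (ProbabilityTheory.setBernoulli Set.univ (Set.projIcc 0 1 zero_le_one u)))) → (∀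 t z, S t z = (Real.cosh t : ℂ) * z + Complex.I * (Real.sinh t : ℂ) * (starRingEnd ℂ) z) → (∃ c : ℝ, 0 < c ∧ ∀ u ∈ Set.Icc (0 : ℝ) (1 / 2), ∀ n : ℕ, 1 ≤ n → c ≤ (μ u).real (Literature.Probability.Percolation.lrCrossing (2 * n) n) ∧ c ≤ (μ u).real (Literature.Probability.Percolation.tbCrossing n (2 * n))) → (∃ t : ℝ, ∀ R : Literature.Probability.RandomPlanarGeometry.ConformalRectangle, R.HasCrossingLimit (fun δ ↦ (μ 0).real (Literature.Probability.Percolation.discreteCrossing (S t '' R.carrier) δ (S t '' R.arc 0) (S t '' R.arc 2))) Literature.Probability.RandomPlanarGeometry.cardyFunction) → (∃ k : ℝ, ∀ (R : Literature.Probability.RandomPlanarGeometry.ConformalRectangle) (t L : ℝ), HasDerivAt (fun s : ℝ ↦ limUnder (nhdsWithin (0 : ℝ) (Set.Ioi 0)) (fun δ ↦ (μ 0).real (Literature.Probability.Percolation.discreteCrossing (S s '' R.carrier) δ (S s '' R.arc 0) (S s '' R.arc 2)))) L t → Filter.Tendsto (fun δ ↦ derivWithin (fun u ↦ (μ u).real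 (Literature.Probability.Percolation.discreteCrossing (S t '' R.carrier) δ (S t '' R.arc 0) (S t '' R.arc 2))) (Set.Ici 0) 0) (nhdsWithin 0 (Set.Ioi 0)) (nhds (k * L))) → ∀ u ∈ Set.Icc (0 : ℝ) (1 / 2), ∃ t : ℝ, ∀ R : Literature.Probability.RandomPlanarGeometry.ConformalRectangle, R.HasCrossingLimit (fun δ ↦ (μ u).real (Literature.Probability.Percolation.discreteCrossing (S t '' R.carrier) δ (S t '' R.arc 0) (S t '' R.arc 2))) Literature.Probability.RandomPlanarGeometry.cardyFunction

/-- item stmt-CriticalPhenomena-6470 · crux · rank 4 · open · by planner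
why it might fail: Instance of BollobasRiordan2010 Conj. 8.2 (open): for 0<u<1/2 μ_u has only translations, the swap x↔y, duality≅π-rotation; KST2023 Thm 1 needs π/2-rotation+reflection (p.5; fails without: §1 rem. 5), Kesten1982 Thm 6.1 an axis reflection AND product measure, BR2010 Thm 5.12 is non-uniform.
sources: BollobasRiordan2010, KohlerSchindlerTassion2023, Kesten1982, Tassion2016, GrimmettManolescuAOP2013, ChayesLei2007
[crux] UNIFORM RSW ON THE SEGMENT: one c > 0 with μ_u[LR crossing of [0,2n]×[0,n]] ≥ c and μ_u[TB
crossing of [0,n]×[0,2n]] ≥ c for all u ∈ [0,1/2], n ≥ 1 (μ_u pinned by its defining equation).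
Inputs available: FKG (u ≤ 1/2), 1-dependence, exact self-duality composed with the π-rotation and
the diagonal reflection x ↔ y (together: open left–right crossing probability exactly 1/2, up to
boundary rounding, for every axis-parallel square; the π-rotation ALONE is not a symmetry: it maps
the {left, down} pairing to {right, up}), criticality (BollobasRiordan2010 Thm 2.1/Cor 2.3),
power-law radius bounds (Thm 8.1). [difficulty: M] -/
@[route_item "route-CriticalPhenomena-ModulusResponse", crux]
def SegmentRSW : Prop :=
  ∀ (μ : ℝ → MeasureTheory.Measure (Literature.Probability.Percolation.BondConfig (Literature.Probability.LatticeModels.Site 2))), (∀ u, μ u = MeasureTheory.Measure.map (fun p : Set (Literature.Probability.LatticeModels.Site 2) × Set (Literature.Probability.LatticeModels.Site 2) ↦ {e | ∃ m, (m ∈ p.1 ∧ e = s(m - Pi.single 0 1, m)) ∨ ((m ∈ p.1 ↔ m ∉ p.2) ∧ e = s(m - Pi.single 1 1, m))}) ((ProbabilityTheory.setBernoulli Set.univ Literature.Probability.Percolation.half).prod (ProbabilityTheory.setBernoulli Set.univ (Set.projIcc 0 1 zero_le_one u)))) → ∃ c : ℝ, 0 < c ∧ ∀ u ∈ Set.Icc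 (0 : ℝ) (1 / 2), ∀ n : ℕ, 1 ≤ n → c ≤ (μ u).real (Literature.Probability.Percolation.lrCrossing (2 * n) n) ∧ c ≤ (μ u).real (Literature.Probability.Percolation.tbCrossing n (2 * n))

/-- item stmt-CriticalPhenomena-6471 · support · rank 5 · closed · proved by Summit.CriticalPhenomena.CardyFormulaZ2.Theorems.smirnovCellAnchor_proof @ c55ff09bd11f (prover) · by planner
why it might fail: Only bookkeeping risk: the ℤ²-cell and 𝕋-site discretisation recipes (meshGraph vs triMeshGraph diagonals, largest component, discreteArc) differ within o(1) of ∂Ω; needs a BR2006 Lemma-14-type sandwich, available in tree for 𝕋.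
sources: Smirnov2001, BollobasRiordan2006, ChayesLei2007, Beffara2008Universal, Smirnov2009CriticalPercolation, Literature.Probability.Percolation.hasCrossingLimit_triDomainCrossingProb_holds
[crux] SMIRNOV AT u = 0 IN THE ℤ² FRAME: μ_0[cross S_{t₀}(R)] → F(η(R)) for every conformal
rectangle R with t₀ = -(log 3)/4. Reason: μ_0-clusters are the site clusters of `triGraph` (cell m ↔
site m, same index set as `triMeshVertices` of the sheared domain), the frame change G(x+iy) = x +
e^{iπ/3}y makes 𝕋 equilateral, and G∘S_{t₀} is a similarity (GᵀG has eigenvalues 3/2, 1/2 on the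
diagonals); then Smirnov's theorem (tree: hasCrossingLimit_triDomainCrossingProb_holds) and a
cell/site discretisation sandwich. [difficulty: M] -/
@[route_item "route-CriticalPhenomena-ModulusResponse", crux]
def SmirnovCellAnchor : Prop :=
  ∀ (μ : ℝ → MeasureTheory.Measure (Literature.Probability.Percolation.BondConfig (Literature.Probability.LatticeModels.Site 2))) (S : ℝ → ℂ → ℂ), (∀ u, μ u = MeasureTheory.Measure.map (fun p : Set (Literature.Probability.LatticeModels.Site 2) × Set (Literature.Probability.LatticeModels.Site 2) ↦ {e | ∃ m, (m ∈ p.1 ∧ e = s(m - Pi.single 0 1, m)) ∨ ((m ∈ p.1 ↔ m ∉ p.2) ∧ e = s(m - Pi.single 1 1, m))}) ((ProbabilityTheory.setBernoulli Set.univ Literature.Probability.Percolation.half).prod (ProbabilityTheory.setBernoulli Set.univ (Set.projIcc 0 1 zero_le_one u)))) → (∀ t z, S t z = (Real.cosh t : ℂ) * z + Complex.I * (Real.sinh t : ℂ) * (starRingEnd ℂ) z) → ∀ R : Literature.Probability.RandomPlanarGeometry.ConformalRectangle, R.HasCrossingLimit (fun δ ↦ (μ 0).real (Literature.Probability.Percolation.discreteCrossing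 (S (-(Real.log 3) / 4) '' R.carrier) δ (S (-(Real.log 3) / 4) '' R.arc 0) (S (-(Real.log 3) / 4) '' R.arc 2))) Literature.Probability.RandomPlanarGeometry.cardyFunction

/-- item stmt-CriticalPhenomena-6472 · support · rank 9 · closed · proved by Summit.CriticalPhenomena.CardyFormulaZ2.Theorems.bondIdentification_proof @ d63a7338e58f (prover) · by planner
sources: Grimmett1999, Beffara2008Universal
[support] at u = 1/2 the cell measure IS Bernoulli bond percolation on ℤ² at 1/2: μ(1/2) =
bondPercolation (zdGraph 2) half ((X, X xor D) with X, D independent fair bits is a pair of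
independent fair bits; every edge of ℤ² is the left or down edge of exactly one vertex; non-edges
never occur). [difficulty: provable-now] -/
@[route_item "route-CriticalPhenomena-ModulusResponse", crux]
def BondIdentification : Prop :=
  ∀ (μ : ℝ → MeasureTheory.Measure (Literature.Probability.Percolation.BondConfig (Literature.Probability.LatticeModels.Site 2))), (∀ u, μ u = MeasureTheory.Measure.map (fun p : Set (Literature.Probability.LatticeModels.Site 2) × Set (Literature.Probability.LatticeModels.Site 2) ↦ {e | ∃ m, (m ∈ p.1 ∧ e = s(m - Pi.single 0 1, m)) ∨ ((m ∈ p.1 ↔ m ∉ p.2) ∧ e = s(m - Pi.single 1 1, m))}) ((ProbabilityTheory.setBernoulli Set.univ Literature.Probability.Percolation.half).prod (ProbabilityTheory.setBernoulli Set.univ (Set.projIcc 0 1 zero_le_one u)))) → μ (1 / 2) = Literature.Probability.Percolation.bondPercolation (Literature.Probability.LatticeModels.zdGraph 2) Literature.Probability.Percolation.half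

/-- item stmt-CriticalPhenomena-6473 · support · rank 9 · closed · proved by Summit.CriticalPhenomena.CardyFormulaZ2.Theorems.squarePinning_proof @ 879260374806 (prover) · by planner
sources: Beffara2008Universal, DKKMO2020Rotational, Werner2007
[support] X → CardyFormulaZ2: the quarter turn ρ of ℤ² is an exact symmetry of `discreteCrossingProb
half` and conjugates S_t to S_{-t}, so X gives F(η(R̃)) = F(η(S_{-2t}R̃)) for all R̃; F is strictly
increasing (tree: strictMonoOn_cardyFunction_holds), so S_{2t} preserves every conformal modulus,
which forces t = 0 (a non-conformal linear map distorts some modulus: the geometric step of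
Beffara2008Universal Prop. 4, cf. named fact BeffaraShearDistortsModulus); t = 0 is CardyFormulaZ2
by `bondDomainCrossingProb_eq`. [difficulty: M] -/
@[route_item "route-CriticalPhenomena-ModulusResponse", crux]
def SquarePinning : Prop :=
  (∀ (S : ℝ → ℂ → ℂ), (∀ t z, S t z = (Real.cosh t : ℂ) * z + Complex.I * (Real.sinh t : ℂ) * (starRingEnd ℂ) z) → ∃ t : ℝ, ∀ R : Literature.Probability.RandomPlanarGeometry.ConformalRectangle, R.HasCrossingLimit (fun δ ↦ Literature.Probability.Percolation.discreteCrossingProb Literature.Probability.Percolation.half (S t '' R.carrier) δ (S t '' R.arc 0) (S t '' R.arc 2)) Literature.Probability.RandomPlanarGeometry.cardyFunction) → CardyFormulaZ2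

/-- item stmt-CriticalPhenomena-14424 · support · rank 10 · closed · proved by Summit.CriticalPhenomena.CardyFormulaZ2.Theorems.linearImageFromSegment_proof (prover) · by planner
sources: Smirnov2001, Beffara2008Universal, BollobasRiordan2010
[support] GLUE cruxes → target (route-choice / badge repair 2026-08-16; answers needs_repair
`route.target-unreachable`: before rev 4 no item concluded the target): the segment chain delivers X
= LinearImageCardyZ2 BY NAME, inputs first — SegmentRSW → SmirnovCellAnchor → SmirnovResponse →
SegmentTransport → BondIdentification → LinearImageCardyZ2. Pure logic, exactly the body of `closes`
(lean-checked sorry-free in the planner's Sketch2.lean, axioms propext/Classical.choice/Quot.sound):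
given stretches S pinned by their formula, instantiate the cell family μ by its defining term
(hypothesis by rfl), feed SegmentTransport μ S with SegmentRSW μ, the anchor ⟨-(log 3)/4,
SmirnovCellAnchor μ S⟩ and SmirnovResponse μ S, take u = 1/2 ∈ [0,1/2], and rewrite μ (1/2) =
bondPercolation (zdGraph 2) half by BondIdentification (`discreteCrossingProb` unfolds by rfl). With
SquarePinning (X → CardyFormulaZ2): closes = SquarePinning ∘ LinearImageFromSegment up to the order
of hypotheses. Rank 10 (not 9) only so that the gate renders this decl AFTER the rank-9 supports
BondIdentification / SquarePinning it quotes (the rank-9 twin SegmentChainGlue,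
stmt-CriticalPhenomena-14142, was rendered before Bo -/
@[route_item "route-CriticalPhenomena-ModulusResponse"]
def LinearImageFromSegment : Prop :=
  SegmentRSW → SmirnovCellAnchor → SmirnovResponse → SegmentTransport → BondIdentification → LinearImageCardyZ2

/-- item stmt-CriticalPhenomena-6474 · assembly · rank 1 · closed · proved by Summit.CriticalPhenomena.CardyFormulaZ2.Theorems.modulusResponse_assembly_proof (prover) · by planner
sources: Smirnov2001, Beffara2008Universal, BollobasRiordan2010
[assembly] SmirnovResponse → SegmentRSW → SmirnovCellAnchor → SegmentTransport → BondIdentification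
→ SquarePinning → CardyFormulaZ2. -/
@[route_item "route-CriticalPhenomena-ModulusResponse"]
def Assembly : Prop :=
  SmirnovResponse → SegmentRSW → SmirnovCellAnchor → SegmentTransport → BondIdentification → SquarePinning → CardyFormulaZ2

/-! D-0027 §2.1 — DECIDING THEOREM (planner-authored via `route open/edit --closes-file`; by planner-rrepair-CriticalPhenomena-ModulusRespo-8c6e0bc2-g2-0 2026-08-15T16:53:25Z):
its hypotheses are this route's items and its conclusion the sub-problem Statement (glue_lint), and it elaborates with this file. -/

@[closes "route-CriticalPhenomena-ModulusResponse"] theorem closes (hResp : SmirnovResponse) (hRSW : SegmentRSW) (hAnchor : SmirnovCellAnchor)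
    (hTrans : SegmentTransport) (hBond : BondIdentification) (hPin : SquarePinning) :
    _root_.CardyFormulaZ2 := by
  -- D-0027 §2.1 deciding theorem (planner, route-repair g2). Pure logic plus one rewrite:
  -- SquarePinning reduces CardyFormulaZ2 to linear-image Cardy X for the pinned stretches S;
  -- for the pinned cell family μ, SegmentTransport at u = 1/2 — fed by SegmentRSW (uniform RSW),
  -- SmirnovCellAnchor (t₀ = -(log 3)/4 at u = 0) and SmirnovResponse (first-order response at u = 0) —
  -- gives linear-image Cardy for μ (1/2), and BondIdentification rewrites μ (1/2) into P_{1/2} on ℤ²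
  -- (`discreteCrossingProb` unfolds by rfl).
  apply hPin
  intro S hS
  suffices h : ∀ μ : ℝ → MeasureTheory.Measure
      (Literature.Probability.Percolation.BondConfig (Literature.Probability.LatticeModels.Site 2)),
      (∀ u, μ u = MeasureTheory.Measure.map
        (fun p : Set (Literature.Probability.LatticeModels.Site 2) ×
            Set (Literature.Probability.LatticeModels.Site 2) ↦
          {e | ∃ m, (m ∈ p.1 ∧ e = s(m - Pi.single 0 1, m)) ∨
            ((m ∈ p.1 ↔ m ∉ p.2) ∧ e = s(m - Pi.single 1 1, m))})
        ((ProbabilityTheory.setBernoulli Set.univ Literature.Probability.Percolation.half).prod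
          (ProbabilityTheory.setBernoulli Set.univ (Set.projIcc 0 1 zero_le_one u)))) →
      ∃ t : ℝ, ∀ R : Literature.Probability.RandomPlanarGeometry.ConformalRectangle,
        R.HasCrossingLimit (fun δ ↦ Literature.Probability.Percolation.discreteCrossingProb
          Literature.Probability.Percolation.half (S t '' R.carrier) δ (S t '' R.arc 0) (S t '' R.arc 2))
          Literature.Probability.RandomPlanarGeometry.cardyFunction from
    h _ (fun _ ↦ rfl)
  intro μ hμ
  have hmem : (1 / 2 : ℝ) ∈ Set.Icc (0 : ℝ) (1 / 2) := ⟨by norm_num, le_rfl⟩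
  obtain ⟨t, ht⟩ := hTrans μ S hμ hS (hRSW μ hμ) ⟨-(Real.log 3) / 4, hAnchor μ S hμ hS⟩
    (hResp μ S hμ hS) (1 / 2) hmem
  refine ⟨t, fun R ↦ ?_⟩
  have hR := ht R
  rw [hBond μ hμ] at hR
  exact hR

end Summit.CriticalPhenomena.CardyFormulaZ2.Theses.ModulusResponse
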